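import Mathlib.RingTheory.RegularLocalRing.Defs
import Mathlib.RingTheory.Valuation.ValuationSubring
import Mathlib.RingTheory.Adjoin.Basic
import Mathlib.RingTheory.Localization.AtPrime.Basic

/-!
# Route RisoStrata — the centre / chart / tower vocabulary of the riso schedule (Defs)

The cruxes `RisoCentresResolve`, `RisoGlobalisation`, `RisoCurves` of route RisoStrata
(`Summits/ResolutionOfSingularities/ResolutionOfSingularities/Theses/RisoStrata.lean`) inline, as
a chain of `let`s over Mathlib, the following objects attached to a finitely generated
`k`-subalgebra `B ⊆ K` of a field: the centre ideal `Cen B d` (intersection of the maximal ideals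
that are singular and fail the cut predicate at level `d`), the blow-up chart
`step B d x = k[B ∪ Cen·x⁻¹]`, the admissibility condition `Valid O B d x` of a chart denominator
with respect to a valuation ring `O`, the `t`-th stage `stage B₀ sched x t` of the tower along a
schedule, and the local ring `loc O B = B_{𝔪_O ∩ B}` read inside `K`.

This file names them ONCE, generically in the cut predicate
`P : ∀ B : Subalgebra k K, Ideal ↥B → ℕ → Prop` (for the route, `P B m d := ¬ Rtd B m (d + 1)`,
the riso-triviality-dimension cut; every definition below then unfolds — by `rfl` — to the
corresponding `let` of the Theses file), so that prover files can state lemmas about the tower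
without copying the forty-line Hahn-series block. Objects posited by the route (D-0016:
`<Route>Defs.lean`); no new mathematics.
-/

-- single-problem summit: the doubled namespace component `ResolutionOfSingularities` is forced
set_option linter.dupNamespace false

namespace Summit.ResolutionOfSingularities.ResolutionOfSingularities.Theorems

variable {k K : Type} [Field k] [Field K] [Algebra k K]

/-- **The centre ideal** `Cen B d` of the riso schedule at level `d` for the cut predicate `P`:
the intersection of the maximal ideals `m` of `B` such that `B_m` is not a regular local ring and
`P B m d` holds (route RisoStrata, `let Cen`). -/
def risoCen (P : ∀ B : Subalgebra k K, Ideal ↥B → ℕ → Prop) (B : Subalgebra k K) (d : ℕ) :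
    Ideal ↥B :=
  ⨅ m ∈ {m : Ideal ↥B | ∃ hm : m.IsMaximal,
    ¬ IsRegularLocalRing (Localization (@Ideal.primeCompl ↥B _ m hm.isPrime)) ∧ P B m d}, m

/-- **The blow-up chart** `step B d x = k[B ∪ Cen(B,d)·x⁻¹] ⊆ K` of denominator `x`
(route RisoStrata, `let step`). -/
def risoStep (P : ∀ B : Subalgebra k K, Ideal ↥B → ℕ → Prop) (B : Subalgebra k K) (d : ℕ)
    (xt : K) : Subalgebra k K :=
  Algebra.adjoin k ((B : Set K) ∪ {y | ∃ a ∈ risoCen P B d, y = (a : K) * xt⁻¹})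

/-- **Admissible denominator**: `x ≠ 0` lies in the centre ideal and is of minimal value for the
valuation ring `O` (`Cen·x⁻¹ ⊆ O`), i.e. the `x`-chart of the blow-up contains the centre of `O`
(route RisoStrata, `let Valid`). -/
def risoValid (P : ∀ B : Subalgebra k K, Ideal ↥B → ℕ → Prop) (O : ValuationSubring K)
    (B : Subalgebra k K) (d : ℕ) (xt : K) : Prop :=
  xt ≠ 0 ∧ (∃ x ∈ risoCen P B d, (x : K) = xt) ∧ ∀ a' ∈ risoCen P B d, (a' : K) * xt⁻¹ ∈ O

/-- **The `t`-th stage of the tower** along the schedule `sched` with denominators `x`, starting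
from `B₀`: `stage B₀ sched x 0 = B₀` and
`stage B₀ sched x (t+1) = step (stage B₀ sched x t) (sched[t]) (x t)` for `t < sched.length`
(route RisoStrata, `let stage`, written as the same left fold). -/
def risoStage (P : ∀ B : Subalgebra k K, Ideal ↥B → ℕ → Prop) (B₀ : Subalgebra k K)
    (sched : List ℕ) (x : ℕ → K) (t : ℕ) : Subalgebra k K :=
  ((sched.take t).zipIdx).foldl (fun B de => risoStep P B de.1 (x de.2)) B₀

/-- **The local ring at the centre of `O`** read inside `K`:
`loc O B = k[{a·s⁻¹ | a, s ∈ B, s⁻¹ ∈ O}]` (for `B ⊆ O` this is `B_{𝔪_O ∩ B}`; route RisoStrata,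
`let loc`). -/
def risoLoc (O : ValuationSubring K) (B : Subalgebra k K) : Subalgebra k K :=
  Algebra.adjoin k {y | ∃ a ∈ B, ∃ s ∈ B, s⁻¹ ∈ O ∧ y = a * s⁻¹}

/-- **Zariski-locality of the cut predicate** (the shape of crux `RtdLocal`): `P` is invariant
under passing from `B` to `B[s⁻¹]` at maximal ideals. -/
def RisoLocal (P : ∀ B : Subalgebra k K, Ideal ↥B → ℕ → Prop) : Prop :=
  ∀ (B : Subalgebra k K) (s : K) (_ : s ∈ B), s ≠ 0 → B.FG →
    ∀ m' : Ideal ↥(Algebra.adjoin k ((B : Set K) ∪ {s⁻¹})), m'.IsMaximal → ∀ d : ℕ,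
      (P (Algebra.adjoin k ((B : Set K) ∪ {s⁻¹})) m' d ↔
        P B (m'.comap (Subalgebra.inclusion
          (show B ≤ Algebra.adjoin k ((B : Set K) ∪ {s⁻¹}) from
            fun _ hb => Algebra.subset_adjoin (Set.mem_union_left _ hb)))) d)

/-- **A schedule resolves the presentation `h` along every valuation** (the shape of the
conclusion of crux `RisoCentresResolve` for one presentation `K = k(hᵢ/hⱼ)`): one finite
schedule such that along every valuation ring `O ⊇ k` of `K`, every chart `k[hᵢ/hⱼ] ⊆ O` and
every admissible choice of denominators, the final stage has a regular local ring at the centre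
of `O`. -/
def RisoSchedule (P : ∀ B : Subalgebra k K, Ideal ↥B → ℕ → Prop) (N : ℕ)
    (h : Fin (N + 1) → K) : Prop :=
  ∃ sched : List ℕ, ∀ O : ValuationSubring K, (∀ c : k, algebraMap k K c ∈ O) →
    ∀ j : Fin (N + 1), (∀ i, h i * (h j)⁻¹ ∈ O) → ∀ x : ℕ → K,
      (∀ t, t < sched.length →
        risoValid P O (risoStage P (Algebra.adjoin k (Set.range fun i => h i * (h j)⁻¹)) sched x t)
          (sched.getD t 0) (x t)) →
      IsRegularLocalRing
        ↥(risoLoc O (risoStage P (Algebra.adjoin k (Set.range fun i => h i * (h j)⁻¹)) sched x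
          sched.length))

/-- `stage B₀ sched x 0 = B₀`. -/
@[simp] theorem risoStage_zero (P : ∀ B : Subalgebra k K, Ideal ↥B → ℕ → Prop)
    (B₀ : Subalgebra k K) (sched : List ℕ) (x : ℕ → K) : risoStage P B₀ sched x 0 = B₀ := rfl

/-- `stage B₀ [] x t = B₀`. -/
@[simp] theorem risoStage_nil (P : ∀ B : Subalgebra k K, Ideal ↥B → ℕ → Prop)
    (B₀ : Subalgebra k K) (x : ℕ → K) (t : ℕ) : risoStage P B₀ [] x t = B₀ := by
  simp [risoStage]

end Summit.ResolutionOfSingularities.ResolutionOfSingularities.Theorems
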